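import Literature.IUT.HodgeTheaters.TemperedCoveringsLevels
import Literature.IUT.HodgeTheaters.TemperedCoveringsCompactSubgroups
import HarnessLib

/-!
# [IUTchI] Prop. 2.4 (i)–(iii): SUB-DAG statements — the printed proof's inputs as NAMED sub-nodes

Mochizuki, *Inter-universal Teichmüller theory I: construction of Hodge theaters*, kurims manuscript
(May 2020), §2, Proposition 2.4 "Profinite Conjugates of Nontrivial Arithmetic Compact Subgroups",
statement p. 50 l. 4–14, proof p. 50 l. 25 – p. 51 l. 20 ([IUTchI] Prop 2.4 pp.50-51)
[claim: Mochizuki2012, status: disputed] (D-0012 claim key; nothing of the series is asserted here; every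
declaration is a `Prop`-valued predicate on abc-iut-L5-t1's interface data `StableCurveTemperedData`
(`TemperedCoverings.lean`, p405450) or a theorem ABOUT those predicates).

SUB-DAG TYPING (D-0068 (1), plan/L5/SUBDAG-IUTchI-Prop24.md, seat abc-iut-w5-d119).  The printed proof of
(i) is kernel-checked in `TemperedCoveringsLevels.lean` (p409071, `prop24i_of_levels`) modulo ANONYMOUS
binders; here each binder becomes a NAMED sub-node with its printed locus, over a packaged tower of levels
(`Prop24Tower` = "the finite index characteristic open subgroups `J ⊆ Δ^tp_X`", p. 50 l. 27, realised as
`J := Δ^tp_X ∩ ι⁻¹(Ĵ)` for subgroups `Ĵ ⊆ Π̂_X`, together with "the pro-`Σ` semi-graph of anabelioids `𝔾_J`"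
and the surjections `J ↠ Π^tp_{𝔾_J}`, `Ĵ ↠ Π̂_{𝔾_J}`):

* (L1) `Prop24Tower.Prop21Levels` — "it thus follows from Proposition 2.1 [applied to `𝔾_J`]" (p. 50 l. 37);
* (L2) `Prop24Tower.LevelsDetect` — "`J ∩ Λ` has nontrivial image … in `Π^tp_{𝔾_J}`" (p. 50 l. 28–33), in
  the QUANTIFIER SHAPE OF PRINT: "there EXISTS a finite index characteristic open subgroup `J` such that …"
  (l. 27–28) and then "by allowing `J` to vary" (l. 40) over the `J′ ⊆ J` — i.e. for each `Λ` at all levels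
  BELOW SOME LEVEL (a `Λ`-dependent depth), not at every level of a fixed tower (see the note on
  `prop24i_of_tower`); its two printed inputs are typed separately: `StronglyTorsionFreeSigma` ("since
  `Δ̂_X` is strongly torsion-free [[Config] Rmk 1.2.2]", l. 27) and `Prop24Tower.SpecializationAb` ("our
  assumption that `p ∉ Σ` implies that the surjection `J ↠ Π^tp_{𝔾_J}` induces an isomorphism between the
  pro-`Σ` completions of the respective abelianizations", l. 31–33);
* (L3) `Prop24Tower.Translate` — "we may assume without loss of generality that `γ` lies in the closure
  `Ĵ` of `J` in `Π̂_X`" (l. 34–36); its input `DeltaHatDense` ("`Δ̂_X` may be identified with the pro-`Σ̂`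
  completion of `Δ^tp_X`", p. 47 l. 11–13) is typed separately;
* (INV) `Prop24Tower.DetectsTempered` — "`Π^tp_X` (respectively, `Π̂_X`) may be written as an inverse limit
  of the topological groups `Π^tp_X/Ker(J ↠ Π^tp_{𝔾_J})` (respectively, `Π̂_X/Ker(Ĵ ↠ Π̂_{𝔾_J})`)" (l. 40–42),
  over the levels below any given level;
* level bookkeeping `LevelsClosed/InDelta/Normal/Open/Cofinal` (p. 50 l. 27, l. 33–35);
* (ii): `Prop24QTower` + `LevelObservation` (p. 50 l. 43 – p. 51 l. 6) + `QDetectsTempered` (p. 51 l. 6–13);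
* (iii): `HasCompactProSigma` ("a pro-`Σ` Sylow subgroup of a decomposition group `⊆ Δ^tp_X` associated to
  an irreducible component of the special fiber", p. 51 l. 15–18).

PROVED here (kernel, over the abstract data): the tower inference `prop24i_of_tower` in the printed
quantifier shape (adapting p409071's per-level argument), `prop24ii_of_qtower`, `prop24iii_of_tower`.
The derivations (L2) ⇐ `StronglyTorsionFreeSigma` + `SpecializationAb` and (L3) ⇐ `DeltaHatDense` are in the
proof-only companion `TemperedCoveringsProp24SubProofs.lean`.  NOT a discharge of the node: the sub-nodes
are statements about the genuine tower (L3/L4 merge objects).  Nothing here bears on [IUTchIII] Cor. 3.12.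
-/

namespace Literature.IUT.HodgeTheaters

open Pointwise
open _root_.Topology
open Literature.AnabelianGeometry.SemiGraphs (IsProSigma)

universe u v

/-! ### Continuous characters to finite abelian `Σ`-groups (the language of "pro-`Σ` abelianizations") -/

/-- "`h ∈ H` has NONTRIVIAL image in the pro-`Σ` completion of the abelianization of `H`", in elementary
form: some homomorphism `χ : H → A` to a finite abelian group of `Σ`-order (in the universe of `P`) with OPEN kernel (i.e. continuous
for the discrete topology on `A`) has `χ(h) ≠ 1`.  (The continuous finite abelian `Σ`-quotients of a
topological group separate exactly the elements that survive in the pro-`Σ` completion of its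
abelianization.) [cite: Mochizuki2012, Prop 2.4(i) p.50] -/
def SigmaCharDetects (S : Set ℕ) {P : Type v} [Group P] [TopologicalSpace P] (H : Subgroup P) (h : H) :
    Prop :=
  ∃ (A : Type v) (_ : CommGroup A) (_ : Finite A) (χ : H →* A),
    IsOpen ((χ.ker : Subgroup H) : Set H) ∧ (∀ p : ℕ, p.Prime → p ∣ Nat.card A → p ∈ S) ∧ χ h ≠ 1

namespace StableCurveTemperedData

variable (D : StableCurveTemperedData.{u})

/-! ### Inputs about `Δ̂_X` itself (p. 47, p. 50 l. 27) -/

/-- **`Δ̂_X` is closed in `Π̂_X`** (it is the kernel of the continuous surjection `Π̂_X ↠ G_k`, p. 47;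
the interface `StableCurveTemperedData` does not record the continuity of `prHat`, so this is a named
input). [cite: Mochizuki2012, §2 p.47] -/
def DeltaHatClosed : Prop := IsClosed (D.DeltaHat : Set D.PiHat)

/-- **Density of `Δ^tp_X` in `Δ̂_X`**: "`Δ̂_X` may be identified with the pro-`Σ̂` completion of `Δ^tp_X`"
(p. 47 l. 11–12) — typed as the consequence used on p. 50 l. 34–36: `Δ̂_X` lies in the closure of
`ι(Δ^tp_X)` in `Π̂_X`. [cite: Mochizuki2012, §2 p.47] -/
def DeltaHatDense : Prop :=
  (D.DeltaHat : Set D.PiHat) ⊆ closure (Set.range fun d : D.DeltaTp => D.ιX (d : D.PiTp))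

/-- **"`Δ̂_X` is strongly torsion-free"** ([Config] Rmk 1.2.2, quoted on p. 50 l. 27: every open subgroup of
`Δ̂_X` has torsion-free abelianization) — typed as the consequence the proof of Prop. 2.4 (i) uses, for the
pro-`Σ` part and in the language of `SigmaCharDetects`: for every open subgroup `H ⊆ Δ̂_X`, if `h ∈ H` is
detected by a continuous character to a finite abelian `Σ`-group, then so is every power `h^n`, `n ≥ 1`.
[cite: Mochizuki2012, Prop 2.4(i) p.50] -/
def StronglyTorsionFreeSigma : Prop :=
  ∀ H : Subgroup D.DeltaHat, IsOpen (H : Set D.DeltaHat) →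
    ∀ (h : H) (n : ℕ), n ≠ 0 →
      SigmaCharDetects D.graph.Sigma H h → SigmaCharDetects D.graph.Sigma H (h ^ n)

/-- **The pro-`Σ` Sylow input of Prop. 2.4 (iii)** (proof, p. 51 l. 15–18: "a pro-`Σ` Sylow subgroup of a
decomposition group `⊆ Δ^tp_X` associated to an irreducible component of the special fiber of `𝔛`") in the
elementary form consumed by `prop24iii_of_prop24i'` (p407271): an infinite profinite pro-`Σ` compact subgroup
`V ⊆ Δ^tp_X`. [cite: Mochizuki2012, Prop 2.4(iii) p.51] -/
def HasCompactProSigma : Prop :=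
  ∃ V : Subgroup D.DeltaTp, IsCompact (V : Set D.DeltaTp) ∧ (V : Set D.DeltaTp).Infinite ∧
    IsProSigma D.graph.Sigma V ∧ TotallyDisconnectedSpace V

/-! ### The tower of levels (p. 50 l. 27–33) -/

/-- The level `J ⊆ Δ^tp_X` cut out by a subgroup `Ĵ ⊆ Π̂_X`: `J := Δ^tp_X ∩ ι⁻¹(Ĵ)` — so that
"`Ĵ ∩ Δ^tp_X = J`" (p. 50 l. 33, the closure `Ĵ` of `J` in `Π̂_X`) holds by construction.
[cite: Mochizuki2012, Prop 2.4(i) p.50] -/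
def levelTp (Jh : Subgroup D.PiHat) : Subgroup D.DeltaTp := Jh.comap (D.ιX.comp D.DeltaTp.subtype)

/-- Membership in a level: `x ∈ J ↔ ι(x) ∈ Ĵ`. [cite: Mochizuki2012, Prop 2.4(i) p.50] -/
theorem mem_levelTp {Jh : Subgroup D.PiHat} {x : D.DeltaTp} :
    x ∈ D.levelTp Jh ↔ D.ιX (x : D.PiTp) ∈ Jh := Iff.rfl

/-- **LEVEL DATA of the proof of Prop. 2.4 (i)** (p. 50 l. 27–33): an index set of levels `i` ("finite index
characteristic open subgroups `J ⊆ Δ^tp_X`"), for each the subgroup `Ĵ_i ⊆ Π̂_X` ("the closure `Ĵ` of `J`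
in `Π̂_X`", with `J_i := Δ^tp_X ∩ ι⁻¹(Ĵ_i)`), the pair `Π^tp_{𝔾_J} ↪ Π̂_{𝔾_J}` of "the pro-`Σ` semi-graph of
anabelioids associated to the special fiber of the stable model … of the finite étale covering of `X ×_k k̄`
determined by `J`" (a `TemperedGraphGroupData`), the continuous surjection `J ↠ Π^tp_{𝔾_J}` and "the natural
surjection on pro-`Σ̂` completions `Ĵ ↠ Π̂_{𝔾_J}`", compatibly.  Pure data (TODO-merge: the specialisation
datum per finite étale cover, abc-iut-L3). [cite: Mochizuki2012, Prop 2.4(i) p.50] -/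
structure Prop24Tower : Type (u + 1) where
  /-- the levels -/
  I : Type u
  /-- `Ĵ_i ⊆ Π̂_X` -/
  Jhat : I → Subgroup D.PiHat
  /-- `Π^tp_{𝔾_{J_i}} ↪ Π̂_{𝔾_{J_i}}` -/
  G : I → TemperedGraphGroupData.{u}
  /-- `J_i ↠ Π^tp_{𝔾_{J_i}}` -/
  πtp : ∀ i, D.levelTp (Jhat i) →* (G i).Tp
  πtp_continuous : ∀ i, Continuous (πtp i)
  πtp_surjective : ∀ i, Function.Surjective (πtp i)
  /-- `Ĵ_i ↠ Π̂_{𝔾_{J_i}}` -/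
  πhat : ∀ i, Jhat i →* (G i).Hat
  /-- compatibility of the two along `Π^tp_{𝔾_J} ↪ Π̂_{𝔾_J}` and `ι : Π^tp_X ↪ Π̂_X` -/
  comp : ∀ i (x : D.DeltaTp) (hx : D.ιX (x : D.PiTp) ∈ Jhat i),
    (G i).ι (πtp i ⟨x, hx⟩) = πhat i ⟨D.ιX (x : D.PiTp), hx⟩

namespace Prop24Tower

variable {D} (T : D.Prop24Tower)

/-- `Ĵ_i` is closed in `Π̂_X` (it IS a closure, p. 50 l. 33). [cite: Mochizuki2012, Prop 2.4(i) p.50] -/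
def LevelsClosed : Prop := ∀ i, IsClosed ((T.Jhat i : Subgroup D.PiHat) : Set D.PiHat)

/-- `Ĵ_i ⊆ Δ̂_X` (`J ⊆ Δ^tp_X`, p. 50 l. 27). [cite: Mochizuki2012, Prop 2.4(i) p.50] -/
def LevelsInDelta : Prop := ∀ i, T.Jhat i ≤ D.DeltaHat

/-- `Ĵ_i ∩ Δ̂_X` is normal in `Δ̂_X` ("characteristic", p. 50 l. 27). [cite: Mochizuki2012, Prop 2.4(i) p.50] -/
def LevelsNormal : Prop := ∀ i, ((T.Jhat i).subgroupOf D.DeltaHat).Normal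

/-- `Ĵ_i ∩ Δ̂_X` is open in `Δ̂_X` ("finite index … open", p. 50 l. 27, l. 34–35).
[cite: Mochizuki2012, Prop 2.4(i) p.50] -/
def LevelsOpen : Prop := ∀ i, IsOpen (((T.Jhat i).subgroupOf D.DeltaHat : Subgroup D.DeltaHat) : Set D.DeltaHat)

/-- The levels are COFINAL among the open subgroups of `Δ̂_X` ("by allowing `J` to vary", p. 50 l. 40: the
characteristic open subgroups of finite index form a basis of neighbourhoods of `1`).
[cite: Mochizuki2012, Prop 2.4(i) p.50] -/
def LevelsCofinal : Prop :=
  ∀ U : Subgroup D.DeltaHat, IsOpen (U : Set D.DeltaHat) → ∃ i, (T.Jhat i).subgroupOf D.DeltaHat ≤ U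

/-- **(L1)** "it thus follows from Proposition 2.1 [applied to `𝔾_J`]" (p. 50 l. 37): Prop. 2.1 (abc-iut-L5-t1's
predicate) for every level graph `𝔾_{J_i}` — kernel-reduced to [SemiAnbd] Thm 3.7 (iii) + [NodNon] Lem 1.9 (ii)
BY NAME (`TemperedGraphGroupData.prop21_byName`, `prop21_of_psc`, `prop21_of_proTree`).
[cite: Mochizuki2012, Prop 2.4(i) p.50] -/
def Prop21Levels : Prop := ∀ i, (T.G i).ProfiniteConjugatesOfCompactSubgroups

/-- **(L2) in the printed quantifier shape** (p. 50 l. 27–33 with l. 40): for every nontrivial pro-`Σ` compact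
`Λ ⊆ Δ^tp_X` THERE IS a level below which, at every level `J`, "`J ∩ Λ` has nontrivial image in `Π^tp_{𝔾_J}`"
(the subgroup `W ⊆ Π̂_X` records "some level `Ĵ_{i₀}`"; the levels `Ĵ_i ⊆ W` are the `J′ ⊆ J` over which
"`J` is allowed to vary"). [cite: Mochizuki2012, Prop 2.4(i) p.50] -/
def LevelsDetect : Prop :=
  ∀ Λ : Subgroup D.DeltaTp, IsCompact (Λ : Set D.DeltaTp) → Λ ≠ ⊥ → IsProSigma D.graph.Sigma Λ →
    ∃ W : Subgroup D.PiHat, (∃ i, T.Jhat i ≤ W) ∧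
      ∀ i, T.Jhat i ≤ W → ∃ x ∈ Λ, ∃ hx : D.ιX (x : D.PiTp) ∈ T.Jhat i, T.πtp i ⟨x, hx⟩ ≠ 1

/-- **(L2b)** "our assumption that `p ∉ Σ` implies that the surjection `J ↠ Π^tp_{𝔾_J}` induces an isomorphism
between the pro-`Σ` completions of the respective abelianizations" (p. 50 l. 31–33) — typed as the half
used: an element of `J` killed by `J ↠ Π^tp_{𝔾_J}` is killed by every continuous character of `Ĵ ∩ Δ̂_X` to a
finite abelian `Σ`-group. [cite: Mochizuki2012, Prop 2.4(i) p.50] -/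
def SpecializationAb : Prop :=
  ∀ i (x : D.DeltaTp) (hx : D.ιX (x : D.PiTp) ∈ T.Jhat i), T.πtp i ⟨x, hx⟩ = 1 →
    ¬ SigmaCharDetects D.graph.Sigma ((T.Jhat i).subgroupOf D.DeltaHat) ⟨D.ιΔ x, hx⟩

/-- **(L3)** "Since the quotient `Π^tp_X` surjects onto `G_k`, and `J` is open of finite index in `Δ^tp_X`, we
may assume without loss of generality that `γ` lies in the closure `Ĵ` of `J` in `Π̂_X`" (p. 50 l. 34–36):
`Π̂_X = ι(Π^tp_X)·Ĵ_i` at every level. [cite: Mochizuki2012, Prop 2.4(i) p.50] -/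
def Translate : Prop := ∀ i (γ : D.PiHat), ∃ t : D.PiTp, (D.ιX t)⁻¹ * γ ∈ T.Jhat i

/-- **(INV)** "Since, by allowing `J` to vary, `Π^tp_X` (respectively, `Π̂_X`) may be written as an inverse
limit of the topological groups `Π^tp_X/Ker(J ↠ Π^tp_{𝔾_J})` (respectively, `Π̂_X/Ker(Ĵ ↠ Π̂_{𝔾_J})`), we thus
conclude that [the original] `γ` lies in `Π^tp_X`" (p. 50 l. 40–42): an element of `Π̂_X` that is tempered
modulo `Ker(Ĵ ↠ Π̂_{𝔾_J})` at every level `J` below some level is tempered.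
[cite: Mochizuki2012, Prop 2.4(i) p.50] -/
def DetectsTempered : Prop :=
  ∀ W : Subgroup D.PiHat, (∃ i, T.Jhat i ≤ W) → ∀ γ : D.PiHat,
    (∀ i, T.Jhat i ≤ W →
      ∃ (t : D.PiTp) (h : (D.ιX t)⁻¹ * γ ∈ T.Jhat i), T.πhat i ⟨(D.ιX t)⁻¹ * γ, h⟩ = 1) →
    γ ∈ D.ιX.range

/-- Closed `Ĵ_i` give closed levels `J_i ⊆ Δ^tp_X` (continuity of `ι`). [cite: Mochizuki2012, Prop 2.4(i) p.50] -/
theorem isClosed_levelTp (hc : T.LevelsClosed) (i : T.I) :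
    IsClosed ((D.levelTp (T.Jhat i) : Subgroup D.DeltaTp) : Set D.DeltaTp) :=
  (hc i).preimage (D.ιX_continuous.comp continuous_subtype_val)

/-- **[IUTchI] Proposition 2.4 (i) from the tower, in the printed quantifier shape** (proof of p. 50,
l. 25–42; the per-level argument is p409071's `prop24i_of_levels`, whose hypothesis `hL2` asks "`J ∩ Λ` has
nontrivial image in `Π^tp_{𝔾_J}`" for EVERY `Λ` at EVERY level of one fixed tower — here, as in print, only at
the levels below a `Λ`-dependent one, (INV) being applied to that cofinal family): (L1) `Prop21Levels`,
(L2) `LevelsDetect`, (L3) `Translate`, (INV) `DetectsTempered`, and closed levels give abc-iut-L5-t1's predicate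
`Prop24i D` AS TYPED.  The translate `δ = ι(t)⁻¹γ ∈ Ĵ` still conjugates `Λ` into `ι(Δ^tp_X)`; `δ·(J ∩ Λ)·δ⁻¹ ⊆
Ĵ ∩ ι(Δ^tp_X) = ι(J)`; Prop. 2.1 for `𝔾_J` applied to the compact nontrivial image of `J ∩ Λ` gives `δ̄ ∈ Π^tp_{𝔾_J}`,
i.e. `ι(t j)⁻¹ γ ∈ Ker(Ĵ ↠ Π̂_{𝔾_J})` for some `j ∈ J`; (INV) concludes. [cite: Mochizuki2012, Prop 2.4(i) p.50] -/
theorem prop24i_of_tower (hc : T.LevelsClosed) (h21 : T.Prop21Levels) (hL2 : T.LevelsDetect)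
    (hL3 : T.Translate) (hINV : T.DetectsTempered) : D.Prop24i := by
  refine ⟨fun Λ hΛc hΛne hΛS γ hγ => ?_⟩
  obtain ⟨W, hW, hgood⟩ := hL2 Λ hΛc hΛne hΛS
  refine hINV W hW γ fun i hi => ?_
  -- move `γ` into `Ĵ_i` by a tempered element: `δ := ι(t)⁻¹ γ ∈ Ĵ_i`
  obtain ⟨t, hδ⟩ := hL3 i γ
  set δ : D.PiHat := (D.ιX t)⁻¹ * γ with hδdef
  -- `δ` still conjugates `Λ` into `ι(Δ^tp_X)` (`Δ^tp_X` is normal in `Π^tp_X`)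
  have hδΛ : ∀ l ∈ Λ, ∃ m : D.DeltaTp, δ * D.ιX (l : D.PiTp) * δ⁻¹ = D.ιX (m : D.PiTp) := by
    intro l hl
    obtain ⟨m₀, hm₀, hm₀eq⟩ := Subgroup.mem_map.mp (hγ l hl)
    have hm : t⁻¹ * m₀ * t ∈ D.DeltaTp := by
      have := (MonoidHom.normal_ker D.prTp).conj_mem m₀ hm₀ t⁻¹
      simpa using this
    refine ⟨⟨t⁻¹ * m₀ * t, hm⟩, ?_⟩
    simp only [hδdef, map_mul, map_inv, hm₀eq, mul_inv_rev, inv_inv]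
    group
  -- the compact nontrivial subgroup `K := π_i(Λ ∩ J_i) ⊆ Π^tp_{𝔾_i}`
  set Ji : Subgroup D.DeltaTp := D.levelTp (T.Jhat i) with hJi
  set Λi : Subgroup Ji := Λ.subgroupOf Ji with hΛi
  set K : Subgroup (T.G i).Tp := Λi.map (T.πtp i) with hK
  have hΛic : IsCompact (Λi : Set Ji) := by
    have : (Λi : Set Ji) = ((↑) : Ji → D.DeltaTp) ⁻¹' (Λ : Set D.DeltaTp) := rfl
    rw [this]
    exact (T.isClosed_levelTp hc i).isClosedEmbedding_subtypeVal.isCompact_preimage hΛc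
  have hKc : IsCompact (K : Set (T.G i).Tp) := by
    rw [hK, Subgroup.coe_map]
    exact hΛic.image (T.πtp_continuous i)
  have hKne : K ≠ ⊥ := by
    obtain ⟨x, hx, hxJ, hx1⟩ := hgood i hi
    intro hbot
    apply hx1
    have : T.πtp i ⟨x, hxJ⟩ ∈ K := Subgroup.mem_map_of_mem _ (by exact hx)
    rwa [hbot, Subgroup.mem_bot] at this
  -- Prop 2.1 for `𝔾_i`, applied to `K` and the image `δ̄` of `δ`
  set δbar : (T.G i).Hat := T.πhat i ⟨δ, hδ⟩ with hδbar
  have hconj : ∀ k ∈ K, δbar * (T.G i).ι k * δbar⁻¹ ∈ (T.G i).ι.range := by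
    rintro _ ⟨⟨x, hxJ⟩, hx, rfl⟩
    have hxΛ : (x : D.DeltaTp) ∈ Λ := hx
    obtain ⟨m, hm⟩ := hδΛ x hxΛ
    -- `δ ι(x) δ⁻¹ ∈ Ĵ_i`, hence `m ∈ J_i`
    have hprod : δ * D.ιX (x : D.PiTp) * δ⁻¹ ∈ T.Jhat i :=
      (T.Jhat i).mul_mem ((T.Jhat i).mul_mem hδ hxJ) ((T.Jhat i).inv_mem hδ)
    have hmJ : D.ιX (m : D.PiTp) ∈ T.Jhat i := hm ▸ hprod
    refine ⟨T.πtp i ⟨m, hmJ⟩, ?_⟩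
    rw [T.comp i x hxJ, hδbar, ← map_mul, ← map_inv, ← map_mul, T.comp i m hmJ]
    congr 1
    apply Subtype.ext
    simp only [Subgroup.coe_mul, Subgroup.coe_inv]
    exact hm.symm
  have hδrange : δbar ∈ (T.G i).ι.range := (h21 i).mem_of_conj_le K hKc hKne δbar hconj
  -- `δ̄ = ι_i(π_i(j))` for some `j ∈ J_i`; then `ι(t j)⁻¹ γ ∈ Ker(Ĵ_i → Π̂_{𝔾_i})`
  obtain ⟨y, hy⟩ := hδrange
  obtain ⟨⟨j, hjJ⟩, rfl⟩ := T.πtp_surjective i y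
  rw [T.comp i j hjJ] at hy
  have hmem : (D.ιX (t * (j : D.PiTp)))⁻¹ * γ ∈ T.Jhat i := by
    have : (D.ιX (t * (j : D.PiTp)))⁻¹ * γ = (D.ιX (j : D.PiTp))⁻¹ * δ := by
      simp only [hδdef, map_mul, mul_inv_rev, mul_assoc]
    rw [this]
    exact (T.Jhat i).mul_mem ((T.Jhat i).inv_mem hjJ) hδ
  refine ⟨t * (j : D.PiTp), hmem, ?_⟩
  have : (⟨(D.ιX (t * (j : D.PiTp)))⁻¹ * γ, hmem⟩ : T.Jhat i) =
      ⟨D.ιX (j : D.PiTp), hjJ⟩⁻¹ * ⟨δ, hδ⟩ := by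
    apply Subtype.ext
    simp only [Subgroup.coe_mul, Subgroup.coe_inv, hδdef, map_mul, mul_inv_rev, mul_assoc]
  rw [this, map_mul, map_inv, hy, ← hδbar, inv_mul_cancel]

/-- **[IUTchI] Prop. 2.4 (iii) from the tower** and the pro-`Σ` Sylow input, `Π^tp_X` Hausdorff: (i) by
`prop24i_of_tower`, then p407271's `prop24iii_of_prop24i'` (whole printed proof of (iii), p. 51 l. 14–20).
[cite: Mochizuki2012, Prop 2.4(iii) p.51] -/
theorem prop24iii_of_tower [T2Space D.PiTp] (hc : T.LevelsClosed) (h21 : T.Prop21Levels)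
    (hL2 : T.LevelsDetect) (hL3 : T.Translate) (hINV : T.DetectsTempered) (hV : D.HasCompactProSigma) :
    D.Prop24iii :=
  D.prop24iii_of_prop24i' (T.prop24i_of_tower hc h21 hL2 hL3 hINV) hV

end Prop24Tower

/-! ### Proposition 2.4 (ii): the quotient tower (p. 50 l. 43 – p. 51 l. 13) -/

/-- **LEVEL DATA of the proof of Prop. 2.4 (ii)** (`Σ̂ = 𝔓𝔯𝔦𝔪𝔢𝔰`; p. 50 l. 43 – p. 51 l. 13): for each level
`J` the quotient pair `Π^tp_X/Ker(J ↠ Π^tp_{𝔾*_J}) ↪ Π̂_X/Ker(Δ̂_X ↠ Π̂_{𝔾*_J})` — `𝔾*_J` "the semi-graph of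
anabelioids whose finite étale coverings correspond to arbitrary admissible coverings of the special fiber"
([SemiAnbd] Example 5.6) — as a `TemperedGraphGroupData`, with the two quotient maps, compatibly.  Pure data.
[cite: Mochizuki2012, Prop 2.4(ii) p.50] -/
structure Prop24QTower : Type (u + 1) where
  /-- the levels -/
  I : Type u
  /-- the quotient pair at level `j` -/
  Q : I → TemperedGraphGroupData.{u}
  /-- `Π^tp_X ↠ Π^tp_X/Ker(J ↠ Π^tp_{𝔾*_J})` -/
  qtp : ∀ j, D.PiTp →* (Q j).Tp
  /-- `Π̂_X ↠ Π̂_X/Ker(Δ̂_X ↠ Π̂_{𝔾*_J})` -/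
  qhat : ∀ j, D.PiHat →* (Q j).Hat
  /-- compatibility along `ι` -/
  hq : ∀ j (t : D.PiTp), (Q j).ι (qtp j t) = qhat j (D.ιX t)

namespace Prop24QTower

variable {D} (T : D.Prop24QTower)

/-- **(OBS)** "this observation" at every level (p. 50 l. 43 – p. 51 l. 6): for `Λ ⊆ Π^tp_X` compact,
nontrivial, with open image in `G_k`, an element of the level quotient of `Π̂_X` conjugating the image of `Λ`
into the tempered quotient is tempered — the ARITHMETIC analogue of Prop. 2.1 ([SemiAnbd] Thm 5.4 (ii) /
Ex 5.6 in place of Thm 3.7 (iii); vertices that "coincide, are adjacent, or admit a common adjacent vertex"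
by [AbsTopII] Prop 1.3 (iv) / [NodNon] Prop 3.9 (i) after restricting to a pro-`Σ` subgroup of inertia;
kernel shape `TemperedGraphGroupData.mem_range_of_proTree` with `Adm Λ` = open image in `G_k`, `Near` =
distance `≤ 2`). [cite: Mochizuki2012, Prop 2.4(ii) p.50] -/
def LevelObservation : Prop :=
  ∀ j (Λ : Subgroup D.PiTp), IsCompact (Λ : Set D.PiTp) → Λ ≠ ⊥ → IsOpen (Λ.map D.prTp : Set D.Gk) →
    ∀ δ : (T.Q j).Hat, (∀ l ∈ Λ, δ * T.qhat j (D.ιX l) * δ⁻¹ ∈ (T.Q j).ι.range) → δ ∈ (T.Q j).ι.range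

/-- **(INV)** for (ii): "[just as in the proof of assertion (i)]" (p. 51 l. 6–13) — an element of `Π̂_X`
tempered in every level quotient is tempered. [cite: Mochizuki2012, Prop 2.4(ii) p.51] -/
def QDetectsTempered : Prop :=
  ∀ γ : D.PiHat, (∀ j, T.qhat j γ ∈ (T.Q j).ι.range) → γ ∈ D.ιX.range

/-- **[IUTchI] Prop. 2.4 (ii) from the quotient tower**: (OBS) + (INV) give abc-iut-L5-t1's `Prop24ii D` AS
TYPED (p409071's `prop24ii_of_levels` with its binders named). [cite: Mochizuki2012, Prop 2.4(ii) p.50] -/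
theorem prop24ii_of_qtower (hLev : T.LevelObservation) (hINV : T.QDetectsTempered) : D.Prop24ii :=
  D.prop24ii_of_levels T.Q T.qtp T.qhat T.hq hLev hINV

end Prop24QTower

end StableCurveTemperedData

end Literature.IUT.HodgeTheaters
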